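import Literature.MathematicalPhysics.QuantumFieldTheory.Balaban1983to89.B4Thm110ZeroTorus
import Literature.MathematicalPhysics.QuantumFieldTheory.Balaban1983to89.B4Lemma24TorusScales

/-!
# B4 «Theorem (Proposition 2.1 of [1])», the Hölder clause (1.9) —
# `|x−x′|^{−α}|(D^η_μG_kf)(x′) − (D^η_μG_kf)(x)| ≤ c₀e^{−δ₀dist({x,x′}, supp f)}‖f‖_∞` — PROVED at `A = 0` ON THE TORUS for
# Bałaban's concrete scalar tower, every volume, every scale `1 ≤ k ≤ K` and every `0 ≤ α < 1`, by the print's (2.38)–(2.39)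

statement-level skeleton of published theorems with citation tags; proofs where landed; nothing here is a claim about the
Yang–Mills mass gap

B4 = T. Bałaban, *Regularity and decay of lattice Green's functions*, Commun. Math. Phys. **89** (1983) 571–597
[cite: Balaban1983RegularityDecay] (journal page = PDF page + 570; held `paper:balaban1983-cmp89-regularity-decay`, p0002, p0003,
p0012, p0014 materialised and read by this seat); B5 = T. Bałaban, *Propagators and renormalization transformations for lattice
gauge theories. I*, Commun. Math. Phys. **95** (1984) 17–40 [cite: Balaban1984PropagatorsI] (p0023 read).  Cell `lit-balaban`
(Phase-2 proof seat p38 gen 4), programme «[2]'s Theorem on the torus at A = 0» = the input `hThm` of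
`B5Prop12Chain.prop12_of_B4_walk` for the B5 Prop. 1.2 census (HOME `ROWS-B5.md` row B5.Prop1.2; owner r02): file F3a, on top of
F2 = `B4Thm110ZeroTorus` ((2.34) at kernel level, the row sums, (1.10)) and F1b = `B4Lemma24TorusScales` (Lemma 2.4 (2.36) on the
torus, uniformly: `holder236_torus`).  Box sibling: `B4Thm19ZeroBox` (pv17, Neumann boxes); the negative-`α` refutation of the
floor-less reading: `B4Thm19ZeroBoxNegAlpha`.

## WHAT IS PRINTED (verbatim; `≦` of the print written `≤`)

* p. 573 [PDF 3]: «**Theorem** (Proposition 2.1 of [1]). For α < 1 there exist positive constants δ₀, c₀, R₀ independent of A, k, Ω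
  and depending on d, M only, c₀ on α also, such that for e sufficiently small and for an arbitrary function f : Ω → R^N, we have
  (1/|x − x′|^α)|U(A(Γ_{x,x′}))(D^η_{A,μ}G_k(Ω, A)f)(x′) − (D^η_{A,μ}G_k(Ω, A)f)(x)| ≤ c₀exp(−δ₀ dist({x, x′}, supp f))‖f‖_∞ (1.9)
  for x, x′ ∈ Ω, and satisfying the condition dist({x, x′}, Ω^c) ≥ R₀. … For some simple sets Ω, e.g. for rectangular
  parallelepipeds, the inequalities hold without any restrictions on the points x, x′, i.e. for all x, x′ ∈ Ω.»
* p. 572 [PDF 2]: «Another common case is to consider operators on subsets of a torus T_η which we identify with a rectangular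
  parallelepiped in ηZ^d with periodic conditions.»
* p. 582 [PDF 12]: (2.34) and Lemma 2.4 (quoted in `B4Thm110ZeroTorus`, `B4Lemma24TorusHolder`); «We use (2.34) with j-th term
  rescaled to the L^{−j}-lattice: |x−x′|^{−α}|(D^η_μG_k(□)f)(x) − (D^η_μG_k(□)f)(x′)| ≤ … Σ_{j} a_j²(L^jη)^{1−α}(L^jη/|x−x′|)^α|…|
  (2.38) hence Lemma 2.4 implies … ≤ Σ_{j=1}^{k−1} a_j²(L^jη)^{1−α}c₁O(1)‖f‖_∞ + η^{1−α}4c₀O(1)‖f‖_∞ ≤ O(1)Σ_{j=0}^{k−1}(L^jη)^{1−α}‖f‖_∞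
  ≤ c′₁‖f‖_∞ (2.39)» ⟦OCR of the display is damaged on the held scan; the structure — one factor (L^jη)^{1−α} per term, (2.36) for
  the difference kernel, the j = 0 term separately, the geometric sum finite for α < 1 — is legible and is what is formalised⟧;
  p. 584 [PDF 14]: «This part of the argument is valid for an arbitrary rectangular parallelepiped □ built of unit blocks».
* B5 p. 39 [PDF 23]: «We use Lemma 2.4 of that paper and the equality (2.34) with □ replaced by the whole torus.»

## WHAT THIS FILE CERTIFIES (kernel-checked, zero `sorry`, no hypotheses in the final theorem)

For Bałaban's CONCRETE scalar torus tower `B1RG242Torus.tower P a msq` (`G^ε_k = (tower …).G k`, `η = ε = L^{−K}` at `k = K`):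
* §1 scale/weight bookkeeping of (2.39): `spacing_eq_rpow` (`L^jε = L^{j−K}`), **`sum_spacing_rpow_le`**
  (`Σ_{1≤j<k}(L^jε)^{1−α} ≤ 1/(L^{1−α}−1)` for `k ≤ K`, `α < 1` — the print's `c′₁`, via `B5FromB4.scale_sum_bound`), `weight_zero_le`
  (`|x₁−x₂|_η^{−α}·ε ≤ 1`: the `η^{1−α}` of the `j = 0` term), `weight_near_eq` (`|x₁−x₂|_η^{−α}(|x₁−x₂|_T/L^j)^α(L^jε) = (L^jε)^{1−α}`).
* §2 `KerBounds.mono`; §3 `term_row_bound_gen` (one term of (2.34) against a source with an arbitrary left row `A(y)`,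
  `|A| ≤ C_Ae^{−δ|proj x − y|}`); §4 **`term_row_bound_pair`** (left row decaying from TWO points, `|A(y)| ≤ C_A(e^{−δ|proj x₁−y|} +
  e^{−δ|proj x₂−y|})`, source vanishing near both: the shape (2.36) produces, «dist({x,x′},y)»).
* §5 `derivG_mulVec_eq` ((2.34) against `f`), **`derivG_sub_eq`** (the printed (2.38): the Hölder difference has the DIFFERENCE KERNEL
  `K1_j(μ;x₂,·) − K1_j(μ;x₁,·)` on the left of the term `j`), `fine_deriv_row_le`, **`deltaK1_pair_bound`** ((2.36) ⇒ the two-point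
  bound), and **`holder_row_bound`** — (1.9) at one volume from the kernel hypotheses (`KerBounds`, the `C^{(0)}` kernel, the Hölder
  bound (2.36) at rate `δ` with constant `c₁`), with the explicit constant `4C₀e^{δ₀}K_d(δ₀/2) + a²c_H/(L^{1−α}−1)` and rate
  `min(δ₀/2, δ/4)` in `εD`.
* §6 **`thm19_zero_torus`** — **(1.9) ON THE TORUS AT `A = 0`, HYPOTHESIS-FREE, UNIFORM IN THE VOLUME AND THE SCALE, RATE BEFORE `α`**:
  for `d ≥ 1`, odd `L > 1`, `a > 0`, `m² ≥ 0` there is `δ₀ > 0` and for every `0 ≤ α < 1` a `c₀(α) > 0` with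
  `|x₁−x₂|_η^{−α}|(∂^ε_μG^ε_kf)(x₂) − (∂^ε_μG^ε_kf)(x₁)| ≤ c₀e^{−δ₀εD}F` for EVERY volume `(m, K)`, level `1 ≤ k ≤ K`, direction `μ`,
  fine sites `x₁ ≠ x₂` and every `f` with `|f| ≤ F` vanishing within fine sup-distance `D ≥ 0` of both points
  (`εD = dist_η({x₁,x₂}, supp f)` is allowed); inputs `B4Thm110ZeroTorus.kerBounds_torus` ((2.35), (2.37)),
  `B4Lemma24TorusScales.holder236_torus` ((2.36)), `B5Leaf237C0Torus.G0unit_decay` (the `C^{(0)}` kernel).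

## DICTIONARY / HONEST SCOPE

(i) `A = 0`, `U(A(Γ_{x,x′})) = 1`, one component; `Ω =` the whole torus (p. 572; the branch «for rectangular parallelepipeds … for
all x, x′»; no `R₀`).  (ii) `|x₁ − x₂| ↦ |x₁−x₂|_η = ε|x₁−x₂|_{T^{(0)}}` (sup torus metric of `B5Ineq137Torus`; the Euclidean `|·|` of
the print is between this and `√d` times it, a change of `c₀` by `d^{α/2}` at most); `dist({x,x′}, supp f) ↦ εD` for any
`0 ≤ D ≤ |x_i − z|_T` on `supp f`, `i = 1, 2`; `‖f‖_∞ ↦` any `F ≥ |f|`.  (iii) **`0 ≤ α < 1` ONLY**: the printed «α < 1» has no floor,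
but for `α < 0` the weight `|x−x′|^{|α|}` is unbounded on large tori and the clause fails (the box refutation
`B4Thm19ZeroBoxNegAlpha.not_thmPrinted_boxFam`); the rate `δ₀` is chosen BEFORE `α`, `c₀` depends on `α` («c₀ on α also»).
(iv) Mass `m² ≥ 0` fixed for the family; the lineage's cap `(L^jε)²m² ≤ m²` is automatic at `j ≤ K`.  (v) Constants existential.
(vi) ROUTE = the print's (2.38)–(2.39) on the torus; the two-point partition of §4 is this file's bookkeeping device for the
«O(1)» row sum of a kernel decaying in `dist({x,x′},y)` (the print does not spell the row sum out).

## NOT-CERTIFIED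

The `B4.EtaSetting` torus family and `B5FromB4.ThmDepPrinted` by name (its `α < 0` instances are false; an `0 ≤ α` variant and the
typed `Ineq19_110` / `Ineq111_112` on the torus family are the sequel F3b); (1.11)–(1.12); background fields `A ≠ 0`; general `Ω`.
-/

namespace Literature.MathematicalPhysics.QuantumFieldTheory.Balaban1983to89

namespace B4Thm19ZeroTorus

open Matrix B1RG242Torus B5Display136Torus B5Leaf237C0Torus B4Ineq115Torus B5Ineq137Torus B4Ineq116Torus
open B4Thm110ZeroTorus

noncomputable section

/-! ## §1 Scale and weight bookkeeping of (2.39): `L^jη` as a real power, `Σ_j (L^jη)^{1−α}`, the Hölder weight `|x−x′|^{−α}` -/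

section Scales

variable (P : Params)

/-- `L^jε = L^{j−K}` as a real power (`ε = L^{−K}`). [cite: Balaban1983RegularityDecay, (2.39) p.582 (the factors «(L^jη)^{1−α}»,
η = L^{−k}); scale bookkeeping] -/
theorem spacing_eq_rpow (j : ℕ) : P.spacing j = (P.L : ℝ) ^ ((j : ℝ) - P.K) := by
  have hL : (0 : ℝ) < P.L := P.cast_L_pos
  rw [Real.rpow_sub hL, Real.rpow_natCast, Real.rpow_natCast]
  unfold Params.spacing Params.eps
  rw [inv_pow, div_eq_mul_inv]

/-- For `j ≤ k ≤ K` and `0 ≤ t`: `(L^jε)^t ≤ (L^{j−k})^t` (`L^jε = L^{j−K} ≤ L^{j−k}`). [cite: Balaban1983RegularityDecay, (2.39) p.582;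
scale bookkeeping] -/
theorem spacing_rpow_le {j k : ℕ} (hk : k ≤ P.K) {t : ℝ} (ht : 0 ≤ t) :
    P.spacing j ^ t ≤ ((P.L : ℝ) ^ ((j : ℝ) - k)) ^ t := by
  have hL1 : (1 : ℝ) ≤ P.L := (one_lt_cast_L P).le
  refine Real.rpow_le_rpow (P.spacing_pos j).le ?_ ht
  rw [spacing_eq_rpow]
  exact Real.rpow_le_rpow_of_exponent_le hL1 (by simp only [sub_le_sub_iff_left]; exact_mod_cast hk)

/-- **THE SCALE SUM OF (2.39)**: `Σ_{1 ≤ j < k} (L^jε)^{1−α} ≤ 1/(L^{1−α} − 1)` for `k ≤ K`, `α < 1` — the printed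
«O(1) Σ_{j=0}^{k−1}(L^jη)^{1−α}‖f‖_∞ ≤ c′₁‖f‖_∞» with `c′₁` finite exactly because `α < 1` (`B5FromB4.scale_sum_bound`).
[cite: Balaban1983RegularityDecay, (2.39) p.582] -/
theorem sum_spacing_rpow_le {k : ℕ} (hk : k ≤ P.K) {α : ℝ} (hα1 : α < 1) :
    ∑ j ∈ Finset.Ico 1 k, P.spacing j ^ (1 - α) ≤ 1 / ((P.L : ℝ) ^ (1 - α) - 1) := by
  have hL1 : (1 : ℝ) < P.L := one_lt_cast_L P
  have hsub : Finset.Ico 1 k ⊆ Finset.range k := fun j hj => Finset.mem_range.mpr (Finset.mem_Ico.mp hj).2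
  calc ∑ j ∈ Finset.Ico 1 k, P.spacing j ^ (1 - α)
      ≤ ∑ j ∈ Finset.range k, P.spacing j ^ (1 - α) :=
        Finset.sum_le_sum_of_subset_of_nonneg hsub fun j _ _ => Real.rpow_nonneg (P.spacing_pos j).le _
    _ ≤ ∑ j ∈ Finset.range k, ((P.L : ℝ) ^ ((j : ℝ) - k)) ^ (1 - α) :=
        Finset.sum_le_sum fun j _ => spacing_rpow_le P hk (by linarith)
    _ ≤ 1 / ((P.L : ℝ) ^ (1 - α) - 1) := B5FromB4.scale_sum_bound _ _ hL1 (by linarith) k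

/-- `s·(s⁻¹)^α = s^{1−α}` for `s > 0`. [folklore] -/
private theorem mul_inv_rpow_eq {s α : ℝ} (hs : 0 < s) : s * (s⁻¹) ^ α = s ^ (1 - α) := by
  rw [Real.inv_rpow hs.le, ← Real.rpow_neg hs.le, Real.rpow_sub hs, Real.rpow_one, Real.rpow_neg hs.le, div_eq_mul_inv]

/-- THE `j = 0` WEIGHT: `|x₁ − x₂|_η^{−α}·ε ≤ 1` for distinct fine sites (`|x₁−x₂|_η = ερ₀ ≥ ε`, `ε ≤ 1`, `0 ≤ α < 1`) — the printed
`η^{1−α}` of (2.39) is at most `1`. [cite: Balaban1983RegularityDecay, (2.39) p.582 («η^{1−α}4c₀O(1)‖f‖_∞»)] -/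
theorem weight_zero_le {ρ₀ α : ℝ} (hρ : 1 ≤ ρ₀) (hα0 : 0 ≤ α) (hα1 : α < 1) :
    ((P.eps * ρ₀)⁻¹) ^ α * P.eps ≤ 1 := by
  have hε0 : 0 < P.eps := P.eps_pos
  have hε1 : P.eps ≤ 1 := eps_le_one (P := P)
  have hρ0 : 0 < ρ₀ := lt_of_lt_of_le one_pos hρ
  have h1 : ((P.eps * ρ₀)⁻¹) ^ α ≤ (P.eps⁻¹) ^ α := by
    refine Real.rpow_le_rpow (by positivity) ?_ hα0
    rw [mul_inv]
    exact mul_le_of_le_one_right (by positivity) (inv_le_one_of_one_le₀ hρ)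
  calc ((P.eps * ρ₀)⁻¹) ^ α * P.eps ≤ (P.eps⁻¹) ^ α * P.eps := mul_le_mul_of_nonneg_right h1 hε0.le
    _ = P.eps ^ (1 - α) := by rw [mul_comm]; exact mul_inv_rpow_eq hε0
    _ ≤ 1 := Real.rpow_le_one hε0.le hε1 (by linarith)

/-- THE NEAR WEIGHT at scale `j` (`|x₁ − x₂|_η ≤ L^jε`): `|x₁−x₂|_η^{−α}·(ρ₀/L^j)^α·L^jε = (L^jε)^{1−α}` (`|x₁−x₂|_η = ερ₀`).
[cite: Balaban1983RegularityDecay, (2.39) p.582 («a_j²(L^jη)^{1−α}c₁»)] -/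
theorem weight_near_eq {ρ₀ α : ℝ} (hρ : 0 < ρ₀) {j : ℕ} :
    ((P.eps * ρ₀)⁻¹) ^ α * ((ρ₀ / (P.L : ℝ) ^ j) ^ α * P.spacing j) = P.spacing j ^ (1 - α) := by
  have hε0 : 0 < P.eps := P.eps_pos
  have hLj : 0 < (P.L : ℝ) ^ j := pow_pos P.cast_L_pos j
  have hs : 0 < P.spacing j := P.spacing_pos j
  have hprod : (P.eps * ρ₀)⁻¹ * (ρ₀ / (P.L : ℝ) ^ j) = (P.spacing j)⁻¹ := by
    unfold Params.spacing; field_simp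
  rw [← mul_assoc, ← Real.mul_rpow (by positivity) (by positivity), hprod, mul_comm]
  exact mul_inv_rpow_eq hs

/-- Distinct sites of a torus of the tower are at sup distance `≥ 1` (the distance is a natural number). [folklore] -/
private theorem one_le_T_of_ne {i : ℕ} {x x' : Site P i} (h : x' ≠ x) : 1 ≤ T P i x x' := by
  have hT : T P i x x' ≠ 0 := fun h0 => h (eq_of_T_eq_zero (P := P) h0).symm
  unfold T B4Sect5Torus.tdist at hT ⊢
  have hn : (Finset.univ.sup (B4Sect5Torus.ccoord (Nv P i) (toT x) (toT x')) : ℕ) ≠ 0 := by exact_mod_cast hT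
  exact_mod_cast Nat.one_le_iff_ne_zero.mpr hn

end Scales

/-! ## §2 Weakening the kernel packages to a common rate -/

section Mono

variable (P : Params)

/-- The kernel package is monotone in its constants: larger `C`, smaller `δ`. [cite: Balaban1983RegularityDecay, Lemma 2.4 p.582;
constant bookkeeping] -/
theorem KerBounds.mono {a msq : ℝ} {k : ℕ} {C δ C' δ' : ℝ} (hC : 0 ≤ C) (h : KerBounds P a msq k C δ) (hCC : C ≤ C')
    (hδδ : δ' ≤ δ) : KerBounds P a msq k C' δ' := by
  refine ⟨fun j hj1 hjk x y => ?_, fun j hj1 hjk y y' => ?_, fun j hj1 hjk μ x y => ?_⟩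
  · exact decay_mono (T_nonneg P j _ _) hCC hC hδδ (h.gq j hj1 hjk x y)
  · exact decay_mono (T_nonneg P j _ _) hCC hC hδδ (h.crs j hj1 hjk y y')
  · exact decay_mono (T_nonneg P j _ _) hCC hC hδδ (h.k1 j hj1 hjk μ x y)

end Mono

/-! ## §3 One term of (2.34) against a source, with a separate constant for the left kernel -/

section Term

variable (P : Params)

/-- `B4Thm110ZeroTorus.term_row_bound` with the left kernel given as ONE ROW `A(y)` at the point `x` with its own constant `C_A`:
`|Σ_{x′}[Σ_{y,y′}A(y)C^{(j)}(y,y′)(Q_jG_j^{resc})(y′,x′)]f(x′)| ≤ C_A·C²K_d(δ/2)²e^{δ/2}K_d(δ/4)·e^{−(δ/4)D/L^j}·F`.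
[cite: Balaban1983RegularityDecay, (2.34)–(2.39) p.582 with (1.9)–(1.10) p.573] -/
theorem term_row_bound_gen {a msq : ℝ} {k : ℕ} {C δ : ℝ} (hC : 0 ≤ C) (hδ : 0 < δ) (hK : KerBounds P a msq k C δ)
    {j : ℕ} (hj1 : 1 ≤ j) (hjk : j < k) (hkm : k ≤ P.m + P.K) (x : Site P 0) (A : Site P j → ℝ) {CA : ℝ} (hCA : 0 ≤ CA)
    (hA : ∀ y : Site P j, |A y| ≤ CA * Real.exp (-(δ * T P j (Site.proj j j x) y)))
    (f : Site P 0 → ℝ) {F D : ℝ} (hF : ∀ z, |f z| ≤ F) (hD : ∀ z, f z ≠ 0 → D ≤ T P 0 x z) :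
    |∑ x' : Site P 0, (∑ y : Site P j, ∑ y' : Site P j,
        A y * Crs P a msq j y y' * (Qk P j * Grs P a msq j) y' x') * f x'|
      ≤ CA * (C ^ 2 * B4Sect5Proof.latticeConst P.d (δ / 2) ^ 2 *
          (Real.exp (δ / 2) * B4Sect5Proof.latticeConst P.d (δ / 4))) *
          Real.exp (-(δ / 4 * (D / (P.L : ℝ) ^ j))) * F := by
  have hj : j ≤ P.m + P.K := hjk.le.trans hkm
  have hw : 0 ≤ (((P.L : ℝ) ^ j) ^ P.d)⁻¹ := by positivity
  have hR : 0 ≤ B4Sect5Proof.latticeConst P.d (δ / 2) := B4Sect5Proof.latticeConst_nonneg _ (by positivity)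
  have hent : ∀ x' : Site P 0,
      |∑ y : Site P j, ∑ y' : Site P j, A y * Crs P a msq j y y' * (Qk P j * Grs P a msq j) y' x'|
        ≤ CA * C * ((((P.L : ℝ) ^ j) ^ P.d)⁻¹ * C) * B4Sect5Proof.latticeConst P.d (δ / 2) ^ 2 *
            Real.exp (-(δ / 2 * T P j (Site.proj j j x) (Site.proj j j x'))) := by
    intro x'
    refine conv_bound P hδ hCA hC (mul_nonneg hw hC) (Site.proj j j x) (Site.proj j j x') A (Crs P a msq j)
      (fun y' => (Qk P j * Grs P a msq j) y' x') hA (hK.crs j hj1 hjk) ?_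
    intro y'
    rw [QkGrs_apply P hj, abs_mul, abs_of_nonneg hw, mul_assoc]
    exact mul_le_mul_of_nonneg_left (hK.gq j hj1 hjk x' y') hw
  have hblock := block_row_sum P hj (show 0 < δ / 2 by positivity) x f hF hD
  calc |∑ x' : Site P 0, (∑ y : Site P j, ∑ y' : Site P j,
          A y * Crs P a msq j y y' * (Qk P j * Grs P a msq j) y' x') * f x'|
      ≤ ∑ x' : Site P 0, |(∑ y : Site P j, ∑ y' : Site P j,
          A y * Crs P a msq j y y' * (Qk P j * Grs P a msq j) y' x') * f x'| := Finset.abs_sum_le_sum_abs _ _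
    _ ≤ ∑ x' : Site P 0, CA * C * ((((P.L : ℝ) ^ j) ^ P.d)⁻¹ * C) * B4Sect5Proof.latticeConst P.d (δ / 2) ^ 2 *
            Real.exp (-(δ / 2 * T P j (Site.proj j j x) (Site.proj j j x'))) * |f x'| := by
        refine Finset.sum_le_sum fun x' _ => ?_
        rw [abs_mul]
        exact mul_le_mul_of_nonneg_right (hent x') (abs_nonneg _)
    _ = CA * C ^ 2 * B4Sect5Proof.latticeConst P.d (δ / 2) ^ 2 *
          ∑ x' : Site P 0, (((P.L : ℝ) ^ j) ^ P.d)⁻¹ *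
            Real.exp (-(δ / 2 * T P j (Site.proj j j x) (Site.proj j j x'))) * |f x'| := by
        rw [Finset.mul_sum]
        refine Finset.sum_congr rfl fun x' _ => ?_
        ring
    _ ≤ CA * C ^ 2 * B4Sect5Proof.latticeConst P.d (δ / 2) ^ 2 *
          (F * (Real.exp (δ / 2) * B4Sect5Proof.latticeConst P.d (δ / 2 / 2)) *
            Real.exp (-(δ / 2 / 2 * (D / (P.L : ℝ) ^ j)))) :=
        mul_le_mul_of_nonneg_left hblock (by positivity)
    _ = _ := by rw [show δ / 2 / 2 = δ / 4 by ring]; ring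

end Term

/-! ## §4 One term of (2.34) with the two-point left kernel of the Hölder difference -/

section Pair

variable (P : Params)

/-- A smooth two-point partition: `|A| ≤ C_A(w₁ + w₂)` splits as `|A·w₁/(w₁+w₂)| ≤ C_Aw₁`, `|A·w₂/(w₁+w₂)| ≤ C_Aw₂`.
[folklore] -/
private theorem partition_bound {A w₁ w₂ CA : ℝ} (hw₁ : 0 < w₁) (hw₂ : 0 < w₂) (hA : |A| ≤ CA * (w₁ + w₂)) :
    |A * (w₁ / (w₁ + w₂))| ≤ CA * w₁ ∧ |A * (w₂ / (w₁ + w₂))| ≤ CA * w₂ := by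
  have hs : 0 < w₁ + w₂ := add_pos hw₁ hw₂
  constructor
  · rw [abs_mul, abs_of_nonneg (div_nonneg hw₁.le hs.le)]
    calc |A| * (w₁ / (w₁ + w₂)) ≤ CA * (w₁ + w₂) * (w₁ / (w₁ + w₂)) :=
          mul_le_mul_of_nonneg_right hA (div_nonneg hw₁.le hs.le)
      _ = CA * w₁ := by field_simp
  · rw [abs_mul, abs_of_nonneg (div_nonneg hw₂.le hs.le)]
    calc |A| * (w₂ / (w₁ + w₂)) ≤ CA * (w₁ + w₂) * (w₂ / (w₁ + w₂)) :=
          mul_le_mul_of_nonneg_right hA (div_nonneg hw₂.le hs.le)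
      _ = CA * w₂ := by field_simp

/-- **ONE TERM OF (2.34) WITH A TWO-POINT LEFT KERNEL** (the shape produced by (2.36), whose decay is in
`dist({x, x′}, y)`): if `|A(y)| ≤ C_A(e^{−δ|proj x₁ − y|} + e^{−δ|proj x₂ − y|})` on `T^{(j)}` and `f` (`|f| ≤ F`) vanishes within
fine distance `D` of BOTH `x₁` and `x₂` (`D ≤ dist({x₁,x₂}, supp f)`), then
`|Σ_{x′}[Σ_{y,y′}A(y)C^{(j)}(y,y′)(Q_jG_j^{resc})(y′,x′)]f(x′)| ≤ 2·C_A·C²K_d(δ/2)²e^{δ/2}K_d(δ/4)·e^{−(δ/4)D/L^j}·F` (split `A`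
by the partition `w_i/(w₁+w₂)`, `w_i = e^{−δ|proj x_i − y|}`, and apply the one-point bound at `x₁` and at `x₂`).
[cite: Balaban1983RegularityDecay, (2.36), (2.38)–(2.39) p.582 with (1.9) p.573 («exp(−δ₀dist({x,x′}, supp f))»)] -/
theorem term_row_bound_pair {a msq : ℝ} {k : ℕ} {C δ : ℝ} (hC : 0 ≤ C) (hδ : 0 < δ) (hK : KerBounds P a msq k C δ)
    {j : ℕ} (hj1 : 1 ≤ j) (hjk : j < k) (hkm : k ≤ P.m + P.K) (x₁ x₂ : Site P 0) (A : Site P j → ℝ) {CA : ℝ}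
    (hCA : 0 ≤ CA)
    (hA : ∀ y : Site P j, |A y| ≤ CA * (Real.exp (-(δ * T P j (Site.proj j j x₁) y)) +
      Real.exp (-(δ * T P j (Site.proj j j x₂) y))))
    (f : Site P 0 → ℝ) {F D : ℝ} (hF : ∀ z, |f z| ≤ F) (hD₁ : ∀ z, f z ≠ 0 → D ≤ T P 0 x₁ z)
    (hD₂ : ∀ z, f z ≠ 0 → D ≤ T P 0 x₂ z) :
    |∑ x' : Site P 0, (∑ y : Site P j, ∑ y' : Site P j,
        A y * Crs P a msq j y y' * (Qk P j * Grs P a msq j) y' x') * f x'|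
      ≤ 2 * (CA * (C ^ 2 * B4Sect5Proof.latticeConst P.d (δ / 2) ^ 2 *
          (Real.exp (δ / 2) * B4Sect5Proof.latticeConst P.d (δ / 4))) *
          Real.exp (-(δ / 4 * (D / (P.L : ℝ) ^ j))) * F) := by
  obtain ⟨A₁, A₂, hA12, hb₁, hb₂⟩ : ∃ A₁ A₂ : Site P j → ℝ, (∀ y, A y = A₁ y + A₂ y) ∧
      (∀ y, |A₁ y| ≤ CA * Real.exp (-(δ * T P j (Site.proj j j x₁) y))) ∧
      (∀ y, |A₂ y| ≤ CA * Real.exp (-(δ * T P j (Site.proj j j x₂) y))) := by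
    refine ⟨fun y => A y * (Real.exp (-(δ * T P j (Site.proj j j x₁) y)) /
        (Real.exp (-(δ * T P j (Site.proj j j x₁) y)) + Real.exp (-(δ * T P j (Site.proj j j x₂) y)))),
      fun y => A y * (Real.exp (-(δ * T P j (Site.proj j j x₂) y)) /
        (Real.exp (-(δ * T P j (Site.proj j j x₁) y)) + Real.exp (-(δ * T P j (Site.proj j j x₂) y)))),
      fun y => ?_, fun y => (partition_bound (Real.exp_pos _) (Real.exp_pos _) (hA y)).1,
      fun y => (partition_bound (Real.exp_pos _) (Real.exp_pos _) (hA y)).2⟩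
    have hs : Real.exp (-(δ * T P j (Site.proj j j x₁) y)) + Real.exp (-(δ * T P j (Site.proj j j x₂) y)) ≠ 0 :=
      (add_pos (Real.exp_pos _) (Real.exp_pos _)).ne'
    dsimp only
    rw [← mul_add, ← add_div, div_self hs, mul_one]
  have hsum : ∑ x' : Site P 0, (∑ y : Site P j, ∑ y' : Site P j,
        A y * Crs P a msq j y y' * (Qk P j * Grs P a msq j) y' x') * f x'
      = ∑ x' : Site P 0, (∑ y : Site P j, ∑ y' : Site P j,
          A₁ y * Crs P a msq j y y' * (Qk P j * Grs P a msq j) y' x') * f x' +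
        ∑ x' : Site P 0, (∑ y : Site P j, ∑ y' : Site P j,
          A₂ y * Crs P a msq j y y' * (Qk P j * Grs P a msq j) y' x') * f x' := by
    rw [← Finset.sum_add_distrib]
    refine Finset.sum_congr rfl fun x' _ => ?_
    rw [← add_mul]
    congr 1
    rw [← Finset.sum_add_distrib]
    refine Finset.sum_congr rfl fun y _ => ?_
    rw [← Finset.sum_add_distrib]
    refine Finset.sum_congr rfl fun y' _ => ?_
    rw [hA12 y]
    ring
  have h₁ := term_row_bound_gen P hC hδ hK hj1 hjk hkm x₁ A₁ hCA hb₁ f hF hD₁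
  have h₂ := term_row_bound_gen P hC hδ hK hj1 hjk hkm x₂ A₂ hCA hb₂ f hF hD₂
  rw [hsum]
  refine (abs_add_le _ _).trans ((add_le_add h₁ h₂).trans_eq ?_)
  ring

end Pair

/-! ## §5 The Hölder clause (1.9) on the torus from kernel bounds (one volume, hypotheses explicit) -/

section Rows

variable (P : Params)

/-- **(2.34) APPLIED TO A SOURCE**: `(∂^ε_μG^ε_k f)(x) = ε Σ_{x′}(∂¹_μG_0^{unit})(x,x′)f(x′) + Σ_{j=1}^{k−1} a_j²(L^jε)
Σ_{x′}[Σ_{y,y′} K1_j(μ;x,y)C^{(j)}(y,y′)(Q_jG_j^{resc})(y′,x′)]f(x′)` (the kernel identity `B4Thm110ZeroTorus.derivG_apply_eq`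
summed against `f`). [cite: Balaban1983RegularityDecay, (2.34), (2.38) p.582] -/
theorem derivG_mulVec_eq {a msq : ℝ} (ha : 0 < a) (hm : 0 ≤ msq) {k : ℕ} (hk : 1 ≤ k) (μ : Fin P.d) (x : Site P 0)
    (f : Site P 0 → ℝ) :
    ((deriv P 0 P.eps μ * (tower P a msq).G k) *ᵥ f) x
      = P.eps * ∑ x', (deriv P 0 1 μ * G0unit P a msq) x x' * f x'
        + ∑ j ∈ Finset.Ico 1 k, B1.aSeq a P.L j ^ 2 * P.spacing j *
            ∑ x', (∑ y : Site P j, ∑ y' : Site P j,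
              K1 P a msq j μ x ⟨j, y⟩ * Crs P a msq j y y' * (Qk P j * Grs P a msq j) y' x') * f x' := by
  have e1 : ((deriv P 0 P.eps μ * (tower P a msq).G k) *ᵥ f) x
      = ∑ x', (deriv P 0 P.eps μ * (tower P a msq).G k) x x' * f x' := rfl
  rw [e1]
  calc ∑ x', (deriv P 0 P.eps μ * (tower P a msq).G k) x x' * f x'
      = ∑ x', (P.eps * (deriv P 0 1 μ * G0unit P a msq) x x' * f x' +
          ∑ j ∈ Finset.Ico 1 k, B1.aSeq a P.L j ^ 2 * P.spacing j *
            (∑ y : Site P j, ∑ y' : Site P j,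
              K1 P a msq j μ x ⟨j, y⟩ * Crs P a msq j y y' * (Qk P j * Grs P a msq j) y' x') * f x') := by
        refine Finset.sum_congr rfl fun x' _ => ?_
        rw [derivG_apply_eq P ha hm hk, add_mul, Finset.sum_mul]
    _ = _ := by
        rw [Finset.sum_add_distrib, Finset.sum_comm, Finset.mul_sum]
        congr 1
        · exact Finset.sum_congr rfl fun x' _ => by ring
        · refine Finset.sum_congr rfl fun j _ => ?_
          rw [Finset.mul_sum]
          exact Finset.sum_congr rfl fun x' _ => by ring

/-- The Hölder difference `(∂^ε_μG^ε_kf)(x₂) − (∂^ε_μG^ε_kf)(x₁)` expanded along (2.34): the `j = 0` rows subtract, and the term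
`j ≥ 1` has the DIFFERENCE KERNEL `K1_j(μ;x₂,y) − K1_j(μ;x₁,y)` on the left — the printed (2.38).
[cite: Balaban1983RegularityDecay, (2.38) p.582] -/
theorem derivG_sub_eq {a msq : ℝ} (ha : 0 < a) (hm : 0 ≤ msq) {k : ℕ} (hk : 1 ≤ k) (μ : Fin P.d)
    (x₁ x₂ : Site P 0) (f : Site P 0 → ℝ) :
    ((deriv P 0 P.eps μ * (tower P a msq).G k) *ᵥ f) x₂ - ((deriv P 0 P.eps μ * (tower P a msq).G k) *ᵥ f) x₁
      = P.eps * (∑ x', (deriv P 0 1 μ * G0unit P a msq) x₂ x' * f x' -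
          ∑ x', (deriv P 0 1 μ * G0unit P a msq) x₁ x' * f x')
        + ∑ j ∈ Finset.Ico 1 k, B1.aSeq a P.L j ^ 2 * P.spacing j *
            ∑ x', (∑ y : Site P j, ∑ y' : Site P j,
              (K1 P a msq j μ x₂ ⟨j, y⟩ - K1 P a msq j μ x₁ ⟨j, y⟩) * Crs P a msq j y y' *
                (Qk P j * Grs P a msq j) y' x') * f x' := by
  rw [derivG_mulVec_eq P ha hm hk μ x₂ f, derivG_mulVec_eq P ha hm hk μ x₁ f, add_sub_add_comm,
    ← Finset.sum_sub_distrib, ← mul_sub]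
  congr 1
  refine Finset.sum_congr rfl fun j _ => ?_
  rw [← mul_sub, ← Finset.sum_sub_distrib]
  congr 1
  refine Finset.sum_congr rfl fun x' _ => ?_
  rw [← sub_mul, ← Finset.sum_sub_distrib]
  congr 1
  refine Finset.sum_congr rfl fun y _ => ?_
  rw [← Finset.sum_sub_distrib]
  refine Finset.sum_congr rfl fun y' _ => ?_
  ring

/-- The `j = 0` row of the derivative against a source vanishing within fine distance `D` of `x`:
`|Σ_{x′}(∂¹_μG_0^{unit})(x,x′)f(x′)| ≤ 2C₀e^{δ₀}K_d(δ₀/2)e^{−(δ₀/2)D}F`. [cite: Balaban1983RegularityDecay, (2.38) p.582 (the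
`C^{(0),η}` term) with (1.9)–(1.10) p.573] -/
theorem fine_deriv_row_le {a msq : ℝ} {C₀ δ₀ : ℝ} (hC₀ : 0 ≤ C₀) (hδ₀ : 0 < δ₀)
    (hG0 : ∀ x x' : Site P 0, |G0unit P a msq x x'| ≤ C₀ * Real.exp (-(δ₀ * T P 0 x x'))) (μ : Fin P.d)
    (x : Site P 0) (f : Site P 0 → ℝ) {F D : ℝ} (hF : ∀ z, |f z| ≤ F) (hD : ∀ z, f z ≠ 0 → D ≤ T P 0 x z) :
    |∑ x', (deriv P 0 1 μ * G0unit P a msq) x x' * f x'|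
      ≤ 2 * C₀ * Real.exp δ₀ * B4Sect5Proof.latticeConst P.d (δ₀ / 2) * Real.exp (-(δ₀ / 2 * D)) * F := by
  have hrow := fine_row_sum P hδ₀ x f hF hD
  have hdb := derivG0unit_bound P hC₀ hδ₀ hG0 μ x
  calc |∑ x', (deriv P 0 1 μ * G0unit P a msq) x x' * f x'|
      ≤ ∑ x', |(deriv P 0 1 μ * G0unit P a msq) x x' * f x'| := Finset.abs_sum_le_sum_abs _ _
    _ ≤ ∑ x', 2 * C₀ * Real.exp δ₀ * (Real.exp (-(δ₀ * T P 0 x x')) * |f x'|) := by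
        refine Finset.sum_le_sum fun x' _ => ?_
        rw [abs_mul, ← mul_assoc]
        exact mul_le_mul_of_nonneg_right (hdb x') (abs_nonneg _)
    _ = 2 * C₀ * Real.exp δ₀ * ∑ x', Real.exp (-(δ₀ * T P 0 x x')) * |f x'| := by rw [Finset.mul_sum]
    _ ≤ 2 * C₀ * Real.exp δ₀ * (F * B4Sect5Proof.latticeConst P.d (δ₀ / 2) * Real.exp (-(δ₀ / 2 * D))) :=
        mul_le_mul_of_nonneg_left hrow (by positivity)
    _ = _ := by ring

/-- **FROM (2.36) TO THE TWO-POINT LEFT KERNEL.** The Hölder kernel bound (2.36) at level `j` (weight `(L^j/|x₁−x₂|_T)^α`,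
decay in `dist({x₁,x₂},y) = min d_{XU}`) gives for the difference kernel
`|K1_j(μ;x₂,y) − K1_j(μ;x₁,y)| ≤ (|x₁−x₂|_T/L^j)^α·c₁e^{δ}·(e^{−δ|proj x₁ − y|} + e^{−δ|proj x₂ − y|})` (block distances;
`e^{−δ min} ≤` sum, `|proj x − y| ≤ d_{XU} + 1`). [cite: Balaban1983RegularityDecay, (2.36) p.582 («dist({x,x′},y)»), (2.38)–(2.39)
p.582] -/
theorem deltaK1_pair_bound {a msq : ℝ} {j : ℕ} (hj : j ≤ P.m + P.K) {δ c₁ α : ℝ} (hc₁ : 0 ≤ c₁) (hδ : 0 ≤ δ)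
    (μ : Fin P.d) {x₁ x₂ : Site P 0} (hne : x₂ ≠ x₁)
    (hH : ∀ y : Site P j, ((P.L : ℝ) ^ j / T P 0 x₁ x₂) ^ α *
        |K1 P a msq j μ x₂ ⟨j, y⟩ - K1 P a msq j μ x₁ ⟨j, y⟩|
          ≤ c₁ * Real.exp (-(δ * min (dXU P j x₁ ⟨j, y⟩) (dXU P j x₂ ⟨j, y⟩))))
    (y : Site P j) :
    |K1 P a msq j μ x₂ ⟨j, y⟩ - K1 P a msq j μ x₁ ⟨j, y⟩|
      ≤ (T P 0 x₁ x₂ / (P.L : ℝ) ^ j) ^ α * c₁ * Real.exp δ *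
          (Real.exp (-(δ * T P j (Site.proj j j x₁) y)) + Real.exp (-(δ * T P j (Site.proj j j x₂) y))) := by
  have hρ : 0 < T P 0 x₁ x₂ := lt_of_lt_of_le one_pos (one_le_T_of_ne P hne)
  have hLj : 0 < (P.L : ℝ) ^ j := pow_pos P.cast_L_pos j
  have hq : 0 < ((P.L : ℝ) ^ j / T P 0 x₁ x₂) ^ α := Real.rpow_pos_of_pos (div_pos hLj hρ) α
  have hqinv : (((P.L : ℝ) ^ j / T P 0 x₁ x₂) ^ α)⁻¹ = (T P 0 x₁ x₂ / (P.L : ℝ) ^ j) ^ α := by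
    rw [← Real.inv_rpow (div_pos hLj hρ).le, inv_div]
  have h1 : |K1 P a msq j μ x₂ ⟨j, y⟩ - K1 P a msq j μ x₁ ⟨j, y⟩| ≤ (T P 0 x₁ x₂ / (P.L : ℝ) ^ j) ^ α *
      (c₁ * Real.exp (-(δ * min (dXU P j x₁ ⟨j, y⟩) (dXU P j x₂ ⟨j, y⟩)))) := by
    have := mul_le_mul_of_nonneg_left (hH y) (inv_pos.mpr hq).le
    rwa [← mul_assoc, inv_mul_cancel₀ hq.ne', one_mul, hqinv] at this
  have hmin : Real.exp (-(δ * min (dXU P j x₁ ⟨j, y⟩) (dXU P j x₂ ⟨j, y⟩)))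
      ≤ Real.exp (-(δ * dXU P j x₁ ⟨j, y⟩)) + Real.exp (-(δ * dXU P j x₂ ⟨j, y⟩)) := by
    rcases min_choice (dXU P j x₁ ⟨j, y⟩) (dXU P j x₂ ⟨j, y⟩) with h | h <;> rw [h]
    · exact le_add_of_nonneg_right (Real.exp_pos _).le
    · exact le_add_of_nonneg_left (Real.exp_pos _).le
  have hconv : ∀ x : Site P 0, Real.exp (-(δ * dXU P j x ⟨j, y⟩))
      ≤ Real.exp δ * Real.exp (-(δ * T P j (Site.proj j j x) y)) := by
    intro x
    rw [← Real.exp_add]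
    have := mul_le_mul_of_nonneg_left (T_proj_le_dXU_add_one P hj x y) hδ
    exact Real.exp_le_exp.mpr (by linarith)
  calc |K1 P a msq j μ x₂ ⟨j, y⟩ - K1 P a msq j μ x₁ ⟨j, y⟩| ≤ _ := h1
    _ ≤ (T P 0 x₁ x₂ / (P.L : ℝ) ^ j) ^ α * (c₁ * (Real.exp δ * Real.exp (-(δ * T P j (Site.proj j j x₁) y)) +
          Real.exp δ * Real.exp (-(δ * T P j (Site.proj j j x₂) y)))) :=
        mul_le_mul_of_nonneg_left (mul_le_mul_of_nonneg_left (hmin.trans (add_le_add (hconv x₁) (hconv x₂))) hc₁)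
          (Real.rpow_nonneg (div_nonneg hρ.le hLj.le) α)
    _ = _ := by ring

/-- **(1.9) ON THE TORUS FROM THE KERNEL BOUNDS** (one volume, `1 ≤ k ≤ K`, `k ≤ m + K`, `0 ≤ α < 1`): if the kernels obey
(2.35), (2.37) at rate `δ` with constant `C` (`KerBounds`), the `C^{(0)}` kernel decays (`hG0`), and the difference kernels obey
the Hölder bound (2.36) with constant `c₁` at rate `δ` (`hH`), then for distinct fine sites `x₁ ≠ x₂`, every direction `μ` and
every source `f` (`|f| ≤ F`) vanishing within fine distance `D ≥ 0` of both points,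
`|x₁−x₂|_η^{−α}|(∂^ε_μG^ε_kf)(x₂) − (∂^ε_μG^ε_kf)(x₁)| ≤ (4C₀e^{δ₀}K_d(δ₀/2) + a²c_H/(L^{1−α}−1))·e^{−min(δ₀/2,δ/4)εD}·F`,
`|x₁−x₂|_η = ε|x₁−x₂|_T`, `c_H = 2c₁e^{δ}C²K_d(δ/2)²e^{δ/2}K_d(δ/4)` (`K_d = B4Sect5Proof.latticeConst`).
This is the printed (2.38)–(2.39): the `j = 0` term by `η^{1−α} ≤ 1` and two one-point rows, the term `j` by (2.36) and
`|x₁−x₂|_η^{−α}(|x₁−x₂|_T/L^j)^α(L^jη) = (L^jη)^{1−α}`, and `Σ_j(L^jη)^{1−α} ≤ 1/(L^{1−α}−1)` («c′₁», finite because `α < 1`).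
[cite: Balaban1983RegularityDecay, Theorem (1.9) p.573, (2.38)–(2.39) p.582, Lemma 2.4 (2.36) p.582, p.584 («valid for an arbitrary
rectangular parallelepiped»), p.572 (torus)] -/
theorem holder_row_bound {a msq : ℝ} (ha : 0 < a) (hm : 0 ≤ msq) {k : ℕ} (hk1 : 1 ≤ k) (hkK : k ≤ P.K)
    (hkm : k ≤ P.m + P.K) {C δ C₀ δ₀ c₁ α : ℝ} (hC : 0 ≤ C) (hδ : 0 < δ) (hC₀ : 0 ≤ C₀) (hδ₀ : 0 < δ₀)
    (hc₁ : 0 ≤ c₁) (hα0 : 0 ≤ α) (hα1 : α < 1) (hK : KerBounds P a msq k C δ)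
    (hG0 : ∀ x x' : Site P 0, |G0unit P a msq x x'| ≤ C₀ * Real.exp (-(δ₀ * T P 0 x x')))
    (μ : Fin P.d) {x₁ x₂ : Site P 0} (hne : x₂ ≠ x₁)
    (hH : ∀ j : ℕ, 1 ≤ j → j < k → ∀ y : Site P j, ((P.L : ℝ) ^ j / T P 0 x₁ x₂) ^ α *
        |K1 P a msq j μ x₂ ⟨j, y⟩ - K1 P a msq j μ x₁ ⟨j, y⟩|
          ≤ c₁ * Real.exp (-(δ * min (dXU P j x₁ ⟨j, y⟩) (dXU P j x₂ ⟨j, y⟩))))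
    (f : Site P 0 → ℝ) {F D : ℝ} (hF : ∀ z, |f z| ≤ F) (hD0 : 0 ≤ D)
    (hD₁ : ∀ z, f z ≠ 0 → D ≤ T P 0 x₁ z) (hD₂ : ∀ z, f z ≠ 0 → D ≤ T P 0 x₂ z) :
    ((P.eps * T P 0 x₁ x₂)⁻¹) ^ α *
        |((deriv P 0 P.eps μ * (tower P a msq).G k) *ᵥ f) x₂ -
          ((deriv P 0 P.eps μ * (tower P a msq).G k) *ᵥ f) x₁|
      ≤ (4 * C₀ * Real.exp δ₀ * B4Sect5Proof.latticeConst P.d (δ₀ / 2) +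
          a ^ 2 * (2 * c₁ * Real.exp δ * (C ^ 2 * B4Sect5Proof.latticeConst P.d (δ / 2) ^ 2 *
            (Real.exp (δ / 2) * B4Sect5Proof.latticeConst P.d (δ / 4)))) * (1 / ((P.L : ℝ) ^ (1 - α) - 1))) *
          Real.exp (-(min (δ₀ / 2) (δ / 4) * (P.eps * D))) * F := by
  have hL1 : (1 : ℝ) < P.L := one_lt_cast_L P
  have hε1 : P.eps ≤ 1 := eps_le_one (P := P)
  have hε0 : 0 < P.eps := P.eps_pos
  have hF0 : 0 ≤ F := (abs_nonneg _).trans (hF x₁)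
  have hεD : 0 ≤ P.eps * D := mul_nonneg hε0.le hD0
  have hρ1 : 1 ≤ T P 0 x₁ x₂ := one_le_T_of_ne P hne
  have hρ0 : 0 < T P 0 x₁ x₂ := lt_of_lt_of_le one_pos hρ1
  set ρ₀ := T P 0 x₁ x₂ with hρ₀
  set w := ((P.eps * ρ₀)⁻¹) ^ α with hw
  have hw0 : 0 ≤ w := Real.rpow_nonneg (by positivity) α
  set m₀ := min (δ₀ / 2) (δ / 4) with hm₀
  have hm₀0 : 0 ≤ m₀ := le_min (by positivity) (by positivity)
  set X := C ^ 2 * B4Sect5Proof.latticeConst P.d (δ / 2) ^ 2 *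
    (Real.exp (δ / 2) * B4Sect5Proof.latticeConst P.d (δ / 4)) with hX
  have hX0 : 0 ≤ X := by
    have h1 := B4Sect5Proof.latticeConst_nonneg P.d (show 0 ≤ δ / 2 by positivity)
    have h2 := B4Sect5Proof.latticeConst_nonneg P.d (show 0 ≤ δ / 4 by positivity)
    positivity
  -- the j = 0 rows: `η^{1−α}·4c₀O(1)‖f‖_∞`
  have h0 : w * |P.eps * (∑ x', (deriv P 0 1 μ * G0unit P a msq) x₂ x' * f x' -
        ∑ x', (deriv P 0 1 μ * G0unit P a msq) x₁ x' * f x')|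
      ≤ 4 * C₀ * Real.exp δ₀ * B4Sect5Proof.latticeConst P.d (δ₀ / 2) * Real.exp (-(m₀ * (P.eps * D))) * F := by
    have hr₂ := fine_deriv_row_le P hC₀ hδ₀ hG0 μ x₂ f hF hD₂
    have hr₁ := fine_deriv_row_le P hC₀ hδ₀ hG0 μ x₁ f hF hD₁
    have hexp : Real.exp (-(δ₀ / 2 * D)) ≤ Real.exp (-(m₀ * (P.eps * D))) := by
      apply Real.exp_le_exp.mpr
      have h1 : m₀ * (P.eps * D) ≤ δ₀ / 2 * (P.eps * D) := mul_le_mul_of_nonneg_right (min_le_left _ _) hεD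
      have h2 : δ₀ / 2 * (P.eps * D) ≤ δ₀ / 2 * D := by
        have : P.eps * D ≤ 1 * D := mul_le_mul_of_nonneg_right hε1 hD0
        rw [one_mul] at this
        exact mul_le_mul_of_nonneg_left this (by positivity)
      linarith
    have hwε : w * P.eps ≤ 1 := weight_zero_le P hρ1 hα0 hα1
    have hK0 := B4Sect5Proof.latticeConst_nonneg P.d (show 0 ≤ δ₀ / 2 by positivity)
    rw [abs_mul, abs_of_nonneg hε0.le, ← mul_assoc]
    calc w * P.eps * |∑ x', (deriv P 0 1 μ * G0unit P a msq) x₂ x' * f x' -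
          ∑ x', (deriv P 0 1 μ * G0unit P a msq) x₁ x' * f x'|
        ≤ 1 * (|∑ x', (deriv P 0 1 μ * G0unit P a msq) x₂ x' * f x'| +
            |∑ x', (deriv P 0 1 μ * G0unit P a msq) x₁ x' * f x'|) :=
          mul_le_mul hwε (abs_sub _ _) (abs_nonneg _) zero_le_one
      _ ≤ 2 * (2 * C₀ * Real.exp δ₀ * B4Sect5Proof.latticeConst P.d (δ₀ / 2) * Real.exp (-(δ₀ / 2 * D)) * F) := by
          rw [one_mul]; linarith
      _ ≤ 2 * (2 * C₀ * Real.exp δ₀ * B4Sect5Proof.latticeConst P.d (δ₀ / 2) * Real.exp (-(m₀ * (P.eps * D))) * F) :=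
          mul_le_mul_of_nonneg_left (mul_le_mul_of_nonneg_right
            (mul_le_mul_of_nonneg_left hexp (by positivity)) hF0) zero_le_two
      _ = _ := by ring
  -- the terms j ≥ 1: `a_j²(L^jη)^{1−α}c₁O(1)‖f‖_∞`
  have hj : ∀ j ∈ Finset.Ico 1 k,
      w * |B1.aSeq a P.L j ^ 2 * P.spacing j *
          ∑ x', (∑ y : Site P j, ∑ y' : Site P j,
            (K1 P a msq j μ x₂ ⟨j, y⟩ - K1 P a msq j μ x₁ ⟨j, y⟩) * Crs P a msq j y y' *
              (Qk P j * Grs P a msq j) y' x') * f x'|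
        ≤ a ^ 2 * (2 * c₁ * Real.exp δ * X) * Real.exp (-(m₀ * (P.eps * D))) * F * P.spacing j ^ (1 - α) := by
    intro j hjm
    obtain ⟨hj1, hjk⟩ := Finset.mem_Ico.mp hjm
    have hjm' : j ≤ P.m + P.K := hjk.le.trans hkm
    have hLj : 0 < (P.L : ℝ) ^ j := pow_pos P.cast_L_pos j
    have hpair := deltaK1_pair_bound P hjm' hc₁ hδ.le μ hne (hH j hj1 hjk)
    have hCA : 0 ≤ (ρ₀ / (P.L : ℝ) ^ j) ^ α * c₁ * Real.exp δ :=
      mul_nonneg (mul_nonneg (Real.rpow_nonneg (div_nonneg hρ0.le hLj.le) α) hc₁) (Real.exp_pos _).le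
    have ht := term_row_bound_pair P hC hδ hK hj1 hjk hkm x₁ x₂
      (fun y => K1 P a msq j μ x₂ ⟨j, y⟩ - K1 P a msq j μ x₁ ⟨j, y⟩) hCA hpair f hF hD₁ hD₂
    have haj : B1.aSeq a P.L j ^ 2 ≤ a ^ 2 := by
      have := B5Leaf235Torus.abs_aSeq_le ha hL1 j
      rw [← sq_abs]; exact pow_le_pow_left₀ (abs_nonneg _) this 2
    have hs0 : 0 ≤ P.spacing j := (P.spacing_pos j).le
    have hexp : Real.exp (-(δ / 4 * (D / (P.L : ℝ) ^ j))) ≤ Real.exp (-(m₀ * (P.eps * D))) :=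
      (exp_scale_le P hkK hjk (by positivity) hD0).trans
        (Real.exp_le_exp.mpr (by nlinarith [mul_le_mul_of_nonneg_right (min_le_right (δ₀ / 2) (δ / 4)) hεD]))
    have hwt : w * ((ρ₀ / (P.L : ℝ) ^ j) ^ α * P.spacing j) = P.spacing j ^ (1 - α) := weight_near_eq P hρ0
    rw [abs_mul, abs_of_nonneg (by positivity : 0 ≤ B1.aSeq a P.L j ^ 2 * P.spacing j)]
    calc w * (B1.aSeq a P.L j ^ 2 * P.spacing j *
          |∑ x', (∑ y : Site P j, ∑ y' : Site P j,
            (K1 P a msq j μ x₂ ⟨j, y⟩ - K1 P a msq j μ x₁ ⟨j, y⟩) * Crs P a msq j y y' *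
              (Qk P j * Grs P a msq j) y' x') * f x'|)
        ≤ w * (a ^ 2 * P.spacing j *
            (2 * ((ρ₀ / (P.L : ℝ) ^ j) ^ α * c₁ * Real.exp δ * X * Real.exp (-(m₀ * (P.eps * D))) * F))) := by
          refine mul_le_mul_of_nonneg_left ?_ hw0
          refine mul_le_mul (mul_le_mul_of_nonneg_right haj hs0) (ht.trans ?_) (abs_nonneg _) (by positivity)
          exact mul_le_mul_of_nonneg_left (mul_le_mul_of_nonneg_right
            (mul_le_mul_of_nonneg_left hexp (mul_nonneg hCA hX0)) hF0) zero_le_two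
      _ = a ^ 2 * (2 * c₁ * Real.exp δ * X) * Real.exp (-(m₀ * (P.eps * D))) * F *
            (w * ((ρ₀ / (P.L : ℝ) ^ j) ^ α * P.spacing j)) := by ring
      _ = _ := by rw [hwt]
  -- assemble (2.39)
  rw [derivG_sub_eq P ha hm hk1 μ x₁ x₂ f]
  refine le_trans (mul_le_mul_of_nonneg_left
    ((abs_add_le _ _).trans (add_le_add le_rfl (Finset.abs_sum_le_sum_abs _ _))) hw0) ?_
  rw [mul_add, Finset.mul_sum]
  refine (add_le_add h0 (Finset.sum_le_sum hj)).trans ?_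
  rw [← Finset.mul_sum]
  have hsum := sum_spacing_rpow_le P hkK hα1
  have hB : 0 ≤ a ^ 2 * (2 * c₁ * Real.exp δ * X) * Real.exp (-(m₀ * (P.eps * D))) * F := by positivity
  refine (add_le_add le_rfl (mul_le_mul_of_nonneg_left hsum hB)).trans (le_of_eq ?_)
  ring

end Rows

/-! ## §6 (1.9) on the torus at `A = 0`, uniformly in the volume and the scale -/

section Uniform

/-- **B4 THEOREM (1.9) ON THE TORUS AT `A = 0` — THE HÖLDER CLAUSE, UNIFORMLY IN THE VOLUME AND THE SCALE, `0 ≤ α < 1`.**  For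
`d ≥ 1`, odd `L > 1`, `a > 0`, `m² ≥ 0` there is `δ₀ > 0` and, for every `0 ≤ α < 1`, a `c₀ = c₀(α) > 0` (functions of
`d, L, a, m²` and `α` only: «independent of A, k, Ω … c₀ on α also») such that for EVERY volume `P = (d, L, m, K)` of Bałaban's
scalar torus tower, every level `1 ≤ k ≤ K`, every direction `μ`, all fine sites `x₁ ≠ x₂` and every source `f` with `|f| ≤ F`
vanishing within fine sup-distance `D ≥ 0` of both `x₁` and `x₂`:
`|x₁ − x₂|_η^{−α}·|(∂^ε_μG^ε_kf)(x₂) − (∂^ε_μG^ε_kf)(x₁)| ≤ c₀e^{−δ₀·εD}F`, `|x₁−x₂|_η = ε|x₁−x₂|_T` — the printed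
`|x−x′|^{−α}|U(A(Γ_{x,x′}))(D^η_{A,μ}G_kf)(x′) − (D^η_{A,μ}G_kf)(x)| ≤ c₀exp(−δ₀dist({x,x′}, supp f))‖f‖_∞` at `A = 0` (`U = 1`)
with no restriction on `x, x′` («for rectangular parallelepipeds … for all x, x′»; the torus is the periodic parallelepiped of
p. 572).  ROUTE: the print's pp. 582–584 — (2.34) (`B1RG242Torus.display243`), (2.38)–(2.39) with Lemma 2.4 on the torus:
(2.35), (2.37) (`B4Thm110ZeroTorus.kerBounds_torus`), (2.36) (`B4Lemma24TorusScales.holder236_torus`), and the `C^{(0)}` kernel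
(`B5Leaf237C0Torus.G0unit_decay`).  NOT COVERED: `α < 0` (the printed «α < 1» without a floor is false for the Hölder quotient,
cf. `B4Thm19ZeroBoxNegAlpha`); external fields `A ≠ 0`; general regions `Ω` with the `R₀`-condition.
[cite: Balaban1983RegularityDecay, Theorem (1.9) p.573, (2.34)–(2.39) p.582, p.584, Lemma 2.4 p.582, p.572 (torus);
Balaban1984PropagatorsI p.39 («with □ replaced by the whole torus»)] -/
theorem thm19_zero_torus (d L : ℕ) (hd : 1 ≤ d) (hL : Odd L ∧ 1 < L) {a : ℝ} (ha : 0 < a) {msq : ℝ} (hmsq : 0 ≤ msq) :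
    ∃ δ₀ : ℝ, 0 < δ₀ ∧ ∀ {α : ℝ}, 0 ≤ α → α < 1 → ∃ c₀ : ℝ, 0 < c₀ ∧ ∀ (P : Params), P.d = d → P.L = L →
      ∀ k : ℕ, 1 ≤ k → k ≤ P.K → ∀ (μ : Fin P.d) (x₁ x₂ : Site P 0), x₂ ≠ x₁ →
        ∀ (f : Site P 0 → ℝ) (F D : ℝ), (∀ z, |f z| ≤ F) → 0 ≤ D →
          (∀ z, f z ≠ 0 → D ≤ T P 0 x₁ z) → (∀ z, f z ≠ 0 → D ≤ T P 0 x₂ z) →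
            ((P.eps * T P 0 x₁ x₂)⁻¹) ^ α *
                |((deriv P 0 P.eps μ * (tower P a msq).G k) *ᵥ f) x₂ -
                  ((deriv P 0 P.eps μ * (tower P a msq).G k) *ᵥ f) x₁|
              ≤ c₀ * Real.exp (-(δ₀ * (P.eps * D))) * F := by
  obtain ⟨C, δK, hC, hδK, hK⟩ := kerBounds_torus d L hd hL ha msq
  obtain ⟨δH, hδH, hH⟩ := B4Lemma24TorusScales.holder236_torus d L hd hL ha msq
  obtain ⟨δ, hδK', hδH', hδ⟩ : ∃ δ : ℝ, δ ≤ δK ∧ δ ≤ δH ∧ 0 < δ :=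
    ⟨min δK δH, min_le_left _ _, min_le_right _ _, lt_min hδK hδH⟩
  -- the j = 0 constants depend on d, L, a, m² only; read them off any volume with these d, L
  obtain ⟨P₀, hP₀d, hP₀L⟩ : ∃ P₀ : Params, P₀.d = d ∧ P₀.L = L := ⟨⟨d, L, 0, 0, hd, hL⟩, rfl, rfl⟩
  set C₀ := 2 / gamma0 L a with hC₀def
  set δ₀ := dK0 d L a msq with hδ₀def
  have hC₀ : 0 ≤ C₀ := by
    rw [hC₀def, ← hP₀L]; exact (div_pos two_pos (gamma0_pos (P := P₀) ha)).le
  have hδ₀ : 0 < δ₀ := by rw [hδ₀def, ← hP₀d, ← hP₀L]; exact dK0_pos (P := P₀) ha hmsq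
  have hL1 : (1 : ℝ) < L := by exact_mod_cast hL.2
  refine ⟨min (δ₀ / 2) (δ / 4), lt_min (by positivity) (by positivity), fun {α} hα0 hα1 => ?_⟩
  obtain ⟨c₁, hc₁, hH1⟩ := hH hα0 hα1
  have hLα : 0 < (L : ℝ) ^ (1 - α) - 1 := by
    have := Real.one_lt_rpow hL1 (by linarith : (0 : ℝ) < 1 - α)
    linarith
  have h1 := B4Sect5Proof.latticeConst_nonneg d (show 0 ≤ δ₀ / 2 by positivity)
  have h2 := B4Sect5Proof.latticeConst_nonneg d (show 0 ≤ δ / 2 by positivity)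
  have h2' := B4Sect5Proof.latticeConst_nonneg d (show 0 ≤ δ / 4 by positivity)
  have hc₁' := hc₁.le
  have h3 : 0 ≤ 1 / ((L : ℝ) ^ (1 - α) - 1) := (div_pos one_pos hLα).le
  refine ⟨4 * C₀ * Real.exp δ₀ * B4Sect5Proof.latticeConst d (δ₀ / 2) +
      a ^ 2 * (2 * c₁ * Real.exp δ * (C ^ 2 * B4Sect5Proof.latticeConst d (δ / 2) ^ 2 *
        (Real.exp (δ / 2) * B4Sect5Proof.latticeConst d (δ / 4)))) * (1 / ((L : ℝ) ^ (1 - α) - 1)) + 1,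
    by positivity, ?_⟩
  intro P hPd hPL k hk1 hkK μ x₁ x₂ hne f F D hF hD0 hD₁ hD₂
  have hkm : k ≤ P.m + P.K := hkK.trans (Nat.le_add_left _ _)
  have hcap : ∀ j, j ≤ P.K → P.spacing j ^ 2 * msq ≤ msq := by
    intro j hjK
    have hs1 : P.spacing j ≤ 1 := by rw [← P.spacing_K]; exact spacing_le_spacing P hjK
    calc P.spacing j ^ 2 * msq ≤ 1 * msq :=
          mul_le_mul_of_nonneg_right (pow_le_one₀ (P.spacing_pos j).le hs1) hmsq
      _ = msq := one_mul _
  have hKB : KerBounds P a msq k C δ :=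
    KerBounds.mono P hC (hK P hPd hPL msq hmsq k hkm (hcap k hkK)) le_rfl hδK'
  have hHB : ∀ j : ℕ, 1 ≤ j → j < k → ∀ y : Site P j, ((P.L : ℝ) ^ j / T P 0 x₁ x₂) ^ α *
      |K1 P a msq j μ x₂ ⟨j, y⟩ - K1 P a msq j μ x₁ ⟨j, y⟩|
        ≤ c₁ * Real.exp (-(δ * min (dXU P j x₁ ⟨j, y⟩) (dXU P j x₂ ⟨j, y⟩))) := by
    intro j hj1 hjk y
    have h := hH1 P hPd hPL msq hmsq j hj1 (hjk.le.trans hkm) (hcap j (hjk.le.trans hkK)) μ x₁ x₂ hne y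
    have hM0 : 0 ≤ min (dXU P j x₁ ⟨j, y⟩) (dXU P j x₂ ⟨j, y⟩) :=
      le_min (dXU_nonneg P j x₁ _) (dXU_nonneg P j x₂ _)
    have := mul_le_mul_of_nonneg_right hδH' hM0
    exact h.trans (mul_le_mul_of_nonneg_left (Real.exp_le_exp.mpr (by linarith)) hc₁.le)
  subst hPd hPL
  have hG0 : ∀ x x' : Site P 0, |G0unit P a msq x x'| ≤ C₀ * Real.exp (-(δ₀ * T P 0 x x')) :=
    fun x x' => G0unit_decay (P := P) ha hmsq x x'
  have hF0 : 0 ≤ F := (abs_nonneg _).trans (hF x₁)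
  have hmain := holder_row_bound P ha hmsq hk1 hkK hkm hC hδ hC₀ hδ₀ hc₁.le hα0 hα1 hKB hG0 μ hne hHB f hF hD0
    hD₁ hD₂
  refine hmain.trans (mul_le_mul_of_nonneg_right (mul_le_mul_of_nonneg_right (by linarith) (Real.exp_pos _).le) hF0)

end Uniform

end

end B4Thm19ZeroTorus

end Literature.MathematicalPhysics.QuantumFieldTheory.Balaban1983to89
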